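import Mathlib
import Summits.CriticalPhenomena.CardyFormulaZ2.Theses.CardyRotToConf
import Literature.Probability.Percolation.LoopBoundaryRegularity
import Literature.Probability.Percolation.LoopRepresentationUniversality

/-!
# Birth skeleton (BC3) for crux `CardyRotToConfLoopRotation` — route `CardyRotToConf` of `CardyFormulaZ2`

Crux item `stmt-CriticalPhenomena-11302`, decl
`Summit.CriticalPhenomena.CardyFormulaZ2.Theses.CardyRotToConf.CardyRotToConfLoopRotation`
(rank 5 of route-CriticalPhenomena-CardyRotToConf): DKKMO rotation invariance of the critical
bond-`ℤ²` interface-loop ensemble in the tree's conventions — for every window radius `R` there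
are `C, c > 0` with `camiaNewmanEDist (law of bondLoopCollection δ 0 (closedBall 0 R)) (law of
bondLoopCollection δ α (closedBall 0 R)) ≤ C δ^c` for all angles `α` and meshes `δ ∈ (0, 1]`.
The crux is VERBATIM the Literature named fact
`Literature.Probability.Percolation.dkkmo_rotation_invariance` (crit-perc.S25; Duminil-Copin–
Kozlowski–Krachun–Manolescu–Oulamara, arXiv:2012.11672v2 Thm 1.2 at `q = 1`), `Iff.rfl`.

## The line = the tree's discharge chain of crit-perc.S25 (two remaining debts, everything else landed)

The proved chain (all sorry-free Literature theorems):
`dkkmo_rotation_invariance_of_universality : dkkmo_universality_coupling → dkkmo_rotation_invariance`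
(LoopRotationInvarianceAssembly, the Remark 1.8 reflection argument, ≈ 1500 lines) ∘
`dkkmo_universality_coupling_of_theorem_1_7 h17 hsign hreg` (IsoradialRectangularLoopsBridge:
printed Thm 1.7 + winding signs + `ℤ²` regularity w.h.p. ⇒ the S25-convention coupling, via the
loop-matching theorem `TypedLoops.hausdorffEDist_collection_le`), with `hsign` (winding signs,
InterfaceLoopWindingSign), density (LoopDensity) and boundary regularity (LoopBoundaryRegularity)
since PROVED, leaving `dkkmo_rotation_invariance_of_theorem_1_7_of_fat (h17) (hfat)`.
Hence exactly two genuine stubs: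

* `stub_printedTheorem17Acute` (XL, the apex): DKKMO's Theorem 1.7 at `q = 1`, `d_CN` part, AS
  PRINTED (paper conventions: typed unbased loops, soft window, coupling distance `cnLawEDist`),
  reduced to acute angles `α ∈ (0, π/2]` and small meshes `δ ∈ (0, 1)` — the proved equivalence
  `dkkmo_theorem_1_7_iff_le_pi_div_two` (horizontal symmetry `α ↦ π − α`, `d_CN ≤ 1`) restores
  `dkkmo_theorem_1_7`. Universality of the loop ensemble across the isoradial rectangular lattices
  `𝕃(α)` (star–triangle track exchanges, half-plane IIC increments, drift symmetry Prop. 3.12,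
  Lemma 4.4 half-angle stability; §§3–4 of the paper). Foreseen split for a crux-plan (NOT filed
  here): the §4.2 density step is proved in tree (`dkkmo_similaritySet_dense_of_half_stable`), so
  Thm 1.7 ⇐ [half-angle stability of the similarity set, Lemma 4.4 + Thm 1.9] + [uniformity in the
  angle, Prop. 3.13 / Lemma 3.2].
* `stub_macroscopicLoopFatness` (L, `ℤ²`-only RSW estimate): with high probability every
  macroscopic interface loop of critical bond percolation on `√2 δ e^{iπ/4} ℤ²` (= `φ_{𝕃(π/2)}`)
  inside the window encloses an `ε`-fat point (a point at distance `> ε = C₁ δ^{c₁}` from the trace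
  with non-zero winding number), above a diameter threshold `r(δ) ∈ [√δ, C₂ δ^{c₂}]` of our choice
  and off an event of probability `≤ C₂ δ^{c₂}`, for `δ ≤ δ₀(R, C₁, c₁)`. This is the one side
  condition of the matching theorem not yet discharged (it feeds `orientedMatching_of_fat`: a fat
  enclosed point is where the winding numbers of two `ε`-close loops can be compared, so that
  orientation types transfer). VERBATIM the binder `hfat` of
  `Literature.Probability.Percolation.dkkmo_rotation_invariance_of_theorem_1_7_of_fat`.

`CardyRotToConfLoopRotation_of` (kernel-checked, no `sorry`): the two stub statements give the
crux BY NAME — `dkkmo_rotation_invariance_of_theorem_1_7_of_fat (dkkmo_theorem_1_7_iff_le_pi_div_two.2 hA) hB`,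
the crux being definitionally `dkkmo_rotation_invariance`. The assembly is one line of text but
not a trivial seam: it invokes ≈ 6000 lines of landed Literature proofs (bridge, reflection
argument, boundary regularity, density, winding signs); the two stubs are the two remaining
mathematical debts of crit-perc.S25 and neither mentions `bondLoopCollection`/`camiaNewmanEDist`.

BC3 probes (registrar folder `bc/probe_*.lean`): `stub → CardyRotToConfLoopRotation`,
`stub → dkkmo_rotation_invariance` (same statement, Literature head symbol) and
`stub → CardyFormulaZ2` by `first | exact? | simpa | aesop` all FAIL for both stubs (neither stub
alone feeds any landed implication to the crux: `_of_fat` needs both).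
Disproof used: none on file (`ledger crux ls stmt-CriticalPhenomena-11302`: no `Disproof.lean`, no
dead lines, 2026-08-17). Negatives index: no refuted statement concerns S25 / Thm 1.7 / loop fatness.

References: arXiv201211672v2 (Thm 1.2, Thm 1.7, Rem 1.8, §4.2), DKKMO2020Rotational, Tassion2024,
GrimmettManolescu2014 (RSW / arm separation on isoradial graphs), CamiaNewman2006 §§4–6 (regularity
of interface loops: no macroscopic thin fjords; 6-arm estimates), AizenmanBurchard1999,
KestenSidoraviciusZhang1998 / Nolin2008 (5-arm exponent 2, a priori 4-arm bounds on `ℤ²`).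
-/

noncomputable section

namespace Summit.CriticalPhenomena.CardyFormulaZ2.Cruxes.CardyRotToConfLoopRotation.Birth

open Set Filter Topology MeasureTheory
open Literature.Probability.LatticeModels Literature.Probability.Percolation
open Literature.Probability.RandomPlanarGeometry

/-! ### Stub signatures (named `Sig.stub_*`, so that the composition's hypotheses are the stubs BY NAME
for the skeleton audit `#h21_check_skeleton`; each `theorem stub_* : Sig.stub_*` below carries the `sorry`) -/

/-- Signature of **Stub A — DKKMO Theorem 1.7 at `q = 1` as printed, acute angles and small meshes (XL).**
There are `c, C > 0` such that for every angle `α ∈ (0, π/2]` and every mesh `δ ∈ (0, 1)` the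
printed Camia–Newman coupling distance (arXiv:2012.11672v2 §1.2 eq. (1)–(2): typed unbased loops,
unoriented distance, soft window `B(0, 1/ε)`) between the loop representation of `φ_{δ𝕃(α)}`
(`isoRectPercolation α`, DKKMO's isoradial weights on the rectangular lattice of angle `α`, read
through `isoRectLoopConfig δ α`) and that of `φ_{δ𝕃(π/2)}` (critical bond percolation on
`√2 δ e^{iπ/4} ℤ²`) is `< C δ^c`. Equivalent to the tree's named fact `dkkmo_theorem_1_7`
(`dkkmo_theorem_1_7_iff_le_pi_div_two`, proved: obtuse angles by the exact horizontal symmetry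
`cnLawEDist_isoRect_pi_sub_pi_div_two`, meshes `δ ≥ 1` by `d_CN ≤ 1`). Why plausibly true: it is
the printed theorem (v2, 2026, Thm 1.7 eq. (4); Tassion's Bourbaki exposé for `q = 1`). Why it
might fail as a FORMAL target: the whole of §§3–4 (track exchanges on mixed isoradial lattices,
half-plane IIC with marked points, the drift-symmetry Proposition 3.12, separation of arms on
isoradial graphs after Grimmett–Manolescu) is unformalised; size XL. Leans on (tree, by name):
`isoRectPercolation`, `isoRectLoopConfig`, `LoopConfig.cnLawEDist`; for a future split:
`dkkmo_similaritySet_dense_of_half_stable`, `dkkmo_theorem_1_7.pairwise`,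
`cnLawEDist_isoRect_pi_sub`. -/
def Sig.stub_printedTheorem17Acute : Prop :=
    ∃ c C : ℝ, 0 < c ∧ 0 < C ∧ ∀ α ∈ Set.Ioc (0 : ℝ) (Real.pi / 2), ∀ δ ∈ Set.Ioo (0 : ℝ) 1,
      Literature.Probability.RandomPlanarGeometry.LoopConfig.cnLawEDist
          (Literature.Probability.Percolation.isoRectPercolation α)
          (Literature.Probability.Percolation.isoRectLoopConfig δ α)
          (Literature.Probability.Percolation.isoRectPercolation (Real.pi / 2))
          (Literature.Probability.Percolation.isoRectLoopConfig δ (Real.pi / 2)) <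
        ENNReal.ofReal (C * δ ^ c)

/-- Signature of **Stub B — fatness of macroscopic interface loops of critical bond-`ℤ²` percolation, with high
probability (L; the last `ℤ²` side condition of the loop-matching bridge).** For every window
radius `R > 0` and every tolerance schedule `ε = C₁ δ^{c₁}` (`C₁, c₁ > 0`) there are `C₂`, `c₂ > 0`,
`δ₀ > 0` and a diameter threshold `r : ℝ → ℝ` with `√δ ≤ r δ ≤ C₂ δ^{c₂}` such that for every mesh
`0 < δ ≤ δ₀` there is a measurable event `G` with `P_{1/2}(Gᶜ) ≤ C₂ δ^{c₂}` on which every based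
interface loop `c` of the configuration on `√2 δ e^{iπ/4} ℤ²` (`bondTypedLoops (√2 δ) (π/4) ω`,
i.e. `φ_{𝕃(π/2)}` of DKKMO §1.4) of diameter `≥ r δ − 2ε` with trace in `closedBall 0 (R + ε)`
encloses an `ε`-fat point: some `z` with `infDist z c.range > ε` and `c.wind z ≠ 0`. (One may take
`r δ = 2ε + δ^{c'}` with `c' < c₁`, `δ₀` so small that `ε ≪ δ^{c'} ≪ R`: the content is that
w.h.p. no interface loop of diameter `≥ ρ = δ^{c'}` in the window bounds an `ε`-thin region.) Why
plausibly true: a thin enclosed region of diameter `ρ` forces, at every point of a cross-section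
spine of length `≳ ρ`, the polychromatic four-arm event from scale `ε` to scale `≍ ρ` (two strands
of the loop `ε`-close, primal/dual hugging arms on either side), i.e. `≳ ρ/ε` disjoint `ε`-balls
each carrying four arms — a standard regularity property of critical interfaces (Camia–Newman 2006
§§4–6 "no thin fjords"; Aizenman–Burchard). Why it might fail / the difficulty: the first-moment
count over the `(R/ε)²` positions needs the `ℤ²` four-arm upper bound `π₄(ε, ρ) ≪ ε ρ`, i.e. a
four-arm exponent `> 1` with room (known on `ℤ²` only through `α₅ = 2` and extra-arm costs,
Kesten 1987 / KSZ 1998 / Nolin 2008), or else a six-arm (`> 2`) pinching argument; every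
deterministic step (thin Jordan region ⇒ aligned pinches) is planar topology of medial polygons
at mesh `√2 δ`, in the corner calculus of `InterfaceLoopClusters` / `InterfaceWindingJump`
(`IsInterfaceLoop.exists_fat_wind_ne_zero` is the lattice-scale `ε = √2/4` case). VERBATIM the
hypothesis `hfat` of `dkkmo_rotation_invariance_of_theorem_1_7_of_fat`. Leans on: `bondTypedLoops`,
`TypedLoops.all`, `CurveClass.wind`, `bondPercolation (zdGraph 2) half`; RSW/arm tools of the tree
(`fourArmProbAt`, `real_fiveArm_le_fourArmProbAt_mul`, `exists_boundaryRegular_event`,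
`ClusterExtremalPoints.real_localTopEvent_le`). -/
def Sig.stub_macroscopicLoopFatness : Prop :=
    ∀ R : ℝ, 0 < R → ∀ C₁ c₁ : ℝ, 0 < C₁ → 0 < c₁ →
      ∃ C₂ c₂ δ₀ : ℝ, 0 < c₂ ∧ 0 < δ₀ ∧ ∃ r : ℝ → ℝ, ∀ δ : ℝ, 0 < δ → δ ≤ δ₀ →
        Real.sqrt δ ≤ r δ ∧ r δ ≤ C₂ * δ ^ c₂ ∧
        ∃ G : Set (Literature.Probability.Percolation.BondConfig (Literature.Probability.LatticeModels.Site 2)),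
          MeasurableSet G ∧
          Literature.Probability.Percolation.bondPercolation (Literature.Probability.LatticeModels.zdGraph 2)
              Literature.Probability.Percolation.half Gᶜ ≤ ENNReal.ofReal (C₂ * δ ^ c₂) ∧
          ∀ ω ∈ G, ∀ c ∈ (Literature.Probability.Percolation.bondTypedLoops (Real.sqrt 2 * δ) (Real.pi / 4) ω).all,
            r δ - 2 * (C₁ * δ ^ c₁) ≤ Metric.diam c.range →
            c.range ⊆ Metric.closedBall 0 (R + C₁ * δ ^ c₁) →
              ∃ z, C₁ * δ ^ c₁ < Metric.infDist z c.range ∧ c.wind z ≠ 0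

/-! ### The stubs -/

/-- **Stub A** — DKKMO Theorem 1.7 at `q = 1` as printed (acute angles, small meshes); see
`Sig.stub_printedTheorem17Acute`. [cite: arXiv201211672v2, Thm 1.7] -/
theorem stub_printedTheorem17Acute : Sig.stub_printedTheorem17Acute := by
  sorry

/-- **Stub B** — fatness w.h.p. of the macroscopic interface loops of critical bond percolation on
`√2 δ e^{iπ/4} ℤ²`; see `Sig.stub_macroscopicLoopFatness`. [cite: arXiv201211672v2, §1.2]
[cite: CamiaNewman2006, §§4–6] -/
theorem stub_macroscopicLoopFatness : Sig.stub_macroscopicLoopFatness := by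
  sorry

/-! ### The composition (sorry-free): the two stubs give the crux BY NAME -/

/-- **Assembly of the line** (kernel-checked, no `sorry`): Stub A restores the printed Theorem 1.7
(`dkkmo_theorem_1_7_iff_le_pi_div_two`), and with Stub B the landed reduction
`dkkmo_rotation_invariance_of_theorem_1_7_of_fat` (bridge to the S25 conventions + boundary
regularity + density + winding signs + the Remark 1.8 reflection argument, all proved in
Literature) yields `dkkmo_rotation_invariance`, which IS the crux (`Iff.rfl`). Concludes the route
decl `CardyRotToConf.CardyRotToConfLoopRotation` BY NAME. -/
theorem CardyRotToConfLoopRotation_of :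
    Sig.stub_printedTheorem17Acute → Sig.stub_macroscopicLoopFatness →
    Summit.CriticalPhenomena.CardyFormulaZ2.Theses.CardyRotToConf.CardyRotToConfLoopRotation :=
  fun hA hB =>
    Literature.Probability.Percolation.dkkmo_rotation_invariance_of_theorem_1_7_of_fat
      (Literature.Probability.Percolation.dkkmo_theorem_1_7_iff_le_pi_div_two.2 hA) hB

/-- Sanity: the crux is definitionally the Literature named fact crit-perc.S25. -/
example : Summit.CriticalPhenomena.CardyFormulaZ2.Theses.CardyRotToConf.CardyRotToConfLoopRotation ↔
    Literature.Probability.Percolation.dkkmo_rotation_invariance :=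
  Iff.rfl

end Summit.CriticalPhenomena.CardyFormulaZ2.Cruxes.CardyRotToConfLoopRotation.Birth

end
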